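import Summits.BirchSwinnertonDyer.BirchSwinnertonDyer.Theses.SchneiderFreeAdditiveX3
import Summits.BirchSwinnertonDyer.BirchSwinnertonDyer.Theorems.SchneiderFreeAdditiveX3LineCharacterTwist
import Summits.BirchSwinnertonDyer.BirchSwinnertonDyer.Theorems.SchneiderFreeAdditiveX3LineCharacterBaseChange
import Summits.BirchSwinnertonDyer.BirchSwinnertonDyer.Theorems.SchneiderFreeAdditiveX3LocalTowerTorsionFiniteOfFacts
import Summits.BirchSwinnertonDyer.BirchSwinnertonDyer.Theorems.SchneiderFreeAdditiveX3AnticycControlAdditiveKFOfRegimes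
import Summits.BirchSwinnertonDyer.BirchSwinnertonDyer.Theorems.SchneiderFreeAdditiveX3ControlGlobalPTorsionF
import Literature.NumberTheory.EllipticCurves.TateCurve.NumberFieldUniformizationTwisted
import HarnessLib

/-!
# Fin_v and the control-corner F-records from the CFT fact and ONE hypothesis: the unit-root
# character of Greenberg's reduction line (FILE 1) — crux `LocalTowerTorsionFiniteX3`
# (stmt-BirchSwinnertonDyer-19546; records 19668 `LocalTowerTorsionFiniteX3F`, 19669 `AnticycControlAdditiveKFF`)

Seat `bsd-schneider-door-c5` (cell `bsd-schneider-ideate`), gen 6; route `SchneiderFreeAdditiveX3`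
(rev 14). GLUE, kernel-checked: the (G-ord, `e = 2`) hypothesis (ii) «canonical line with its
character at `(K, 𝔭)`» of gen 5's `stub_finV_gordTwo_of_lineCharacter` (p446206) was factored as
FILE 1 (unit-root Frobenius character of Greenberg's reduction line `C_v(V)` of the good-ordinary
`p*`-twist model, at `(ℚ, v)`; door-c6 g3, in flight), FILE 2 (twist transport with character,
`…LineCharacterTwist`, p457112) and FILE 3 (`(ℚ̄, D_v) → (K̄, D_𝔭)` at a split `p`,
`…LineCharacterBaseChange`, door-c4 g5 p457099); the (M) half is door-c2 g5's `lineCharacter_subM` /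
`localTowerTorsionFiniteX3_of_facts_of_stub_gordTwo` (p451736 / p452324) behind the PROVED Tate
uniformisation `TateCurve.Silverman1994_thmV53_corV54_tateUniformisation_holds`. Composing them, the
ONLY non-cited input left is FILE 1, spelled out here as the hypothesis `UnitRootCharacter`-shape
binder `hunit` (no definition: the `∀`-statement is written inline in every signature):

* `hLineRat_gordTwo_of_unitRoot` — FILE 3's `ℚ`-side input `hLineQ` from `hunit` (FILE 2 §3);
* `stub_finV_gordTwo_of_CFT_of_unitRoot` — the REGISTERED stub `stub_finV_gordTwo` of crux r5
  (signature verbatim) from {CFT fact (i), `hunit`};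
* `localTowerTorsionFiniteX3_of_CFT_of_unitRoot` — the crux decl `LocalTowerTorsionFiniteX3` BY NAME
  from {CFT fact (i), `hunit`} (A41 discharged by `_holds`);
* `localTowerTorsionFiniteX3F_of_unitRoot` / `anticycControlAdditiveKFF_of_unitRoot` — the rev-14
  F-records `LocalTowerTorsionFiniteX3F` (stmt-19668) and `AnticycControlAdditiveKFF` (stmt-19669) BY
  NAME from `hunit` ALONE (closers: `fun hFILE1 ↦ localTowerTorsionFiniteX3F_of_unitRoot hFILE1`).

`hunit` (FILE 1, Greenberg LNM 1716 §2 p. 70 «`φψ⁻¹ = χ`» on the whole decomposition group; in print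
for good ordinary reduction, Serre 1972 §1.11 / Silverman VII + the Weil pairing): for every odd...
any prime `p`, place `v ∋ p` of `ℚ`, and globally minimal GOOD ORDINARY `V/ℚ`, some `α ∈ ℤ_p^×` with
`α² = aα − p` such that every `σ ∈ Γ_{ℚ_v}` of Frobenius degree `n` acts on the `p^k`-torsion of
Greenberg's reduction line `C_v(V) = ker(V[p^∞] → Ṽ(k̄_v))` (X2 `reductionDatum`) by any integer
`N ≡ χ_p(res σ)·α^{−n} (mod p^k)`. Proofs only (no definition, no named fact, no `sorry`); `--supports`
stmt-BirchSwinnertonDyer-19546; closes nothing by itself (conditional on FILE 1); BSD is not advanced.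
References: [GreenbergLNM1716] §2 pp. 69–70; [JetchevSkinnerWan2017] §3.3 Prop. 3.3.4 Case 3(b),
Remark 3.3.5 (arXiv:1512.06894 p. 13); [SilvermanATAEC1994] Ch. V Thm. 5.3, Cor. 5.4.
-/

noncomputable section

open scoped Classical

namespace Summit.BirchSwinnertonDyer.BirchSwinnertonDyer.Theorems.SchneiderFreeAdditiveX3

open NumberField IsDedekindDomain Field WeierstrassCurve
  Literature.NumberTheory.EllipticCurves Literature.NumberTheory.EllipticCurves.GreenbergSelmer
  Literature.NumberTheory.GaloisRepresentations
  Literature.NumberTheory.EllipticCurves.Rank1Residual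
  Summit.BirchSwinnertonDyer.Rank1Residual.X11b
  Summit.BirchSwinnertonDyer.Rank1Residual.X2.GreenbergVatsalReductionDatum
  Summit.BirchSwinnertonDyer.BirchSwinnertonDyer.Theses.SchneiderFreeAdditiveX3

set_option linter.dupNamespace false

/-- **FILE 3's `ℚ`-side input from FILE 1.** Granted the unit-root character of Greenberg's reduction
line for every globally minimal good-ordinary `V/ℚ` at every place `v ∋ p` (`hunit`, FILE 1), every `W`
of the cell X3 ∩ (G-ord, `e = 2`) carries at every `v ∋ p` a `D_v`-stable line WITH character on
`E[p^∞](ℚ̄)` — the hypothesis `hLineQ` of door-c4 g5's `hLine_gordTwo_of_rat` /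
`stub_finV_gordTwo_of_lineCharacterRat` (FILE 2 §3 `lineCharacter_rat_of_subGordTwo_of_unitRoot`).
[cite: GreenbergLNM1716, §2 pp. 69–70] [cite: EmertonPollackWeston2006, §3.1 (eq:ordes) (arXiv:math/0404484 p. 17)] -/
theorem hLineRat_gordTwo_of_unitRoot
    (hunit : ∀ (p : ℕ) [Fact p.Prime] (v : HeightOneSpectrum (𝓞 ℚ))
      (hpv : ((p : ℕ) : 𝓞 ℚ) ∈ v.asIdeal) (V : WeierstrassCurve ℚ) [V.IsElliptic] [V.IsGloballyMinimal],
      GoodOrd V p → ∀ (hΔ : ¬ (p : ℤ) ∣ minimalDiscriminantInt V), ∃ (a : ℤ) (α : ℤ_[p]ˣ),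
      ((α : ℤ_[p])) ^ 2 = a * (α : ℤ_[p]) - p ∧
      ∀ (σ : absoluteGaloisGroup (v.adicCompletion ℚ)) (n : ℕ), IsFrobPow σ (n : ℤ) →
        ∀ (k : ℕ) (c : V.geomPrimaryTorsion p), c ∈ (reductionDatum V p hpv hΔ).plus → p ^ k • c = 0 →
          ∀ N : ℤ, ((N : ℤ_[p]) -
              ((GaloisRep.cyclotomicCharacter ℚ p (absGaloisRestrict ℚ (v.adicCompletion ℚ) σ) *
                (α⁻¹) ^ n : ℤ_[p]ˣ) : ℤ_[p]) ∈ (Ideal.span {(p : ℤ_[p]) ^ k} : Ideal ℤ_[p])) →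
            absGaloisRestrict ℚ (v.adicCompletion ℚ) σ • c = N • c) :
    ∀ (W : WeierstrassCurve ℚ) [W.IsElliptic] [W.IsGloballyMinimal] (p : ℕ) [Fact p.Prime],
      W.analyticRank = 1 → p ≠ 2 → Literature.NumberTheory.EllipticCurves.Rank1Residual.ClassX3 W p →
        Summit.BirchSwinnertonDyer.Rank1Residual.Additive.SubGordTwo W p →
        ∀ (v : HeightOneSpectrum (𝓞 ℚ)), ((p : ℕ) : 𝓞 ℚ) ∈ v.asIdeal →
          ∃ (C : AddSubgroup (W.geomPrimaryTorsion p)) (a : ℤ) (α : ℤ_[p]ˣ),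
            (∀ d ∈ decomp v, ∀ c ∈ C, d • c ∈ C) ∧
            Set.ncard {c : W.geomPrimaryTorsion p | c ∈ C ∧ p • c = 0} ≤ p ∧
            (∀ k : ℕ, ∃ c ∈ C, addOrderOf c = p ^ k) ∧
            (∃ τ ∈ decomp v, ∀ m : W.geomPrimaryTorsion p, τ • m + m ∈ C) ∧
            ((α : ℤ_[p])) ^ 2 = a * (α : ℤ_[p]) - p ∧
            (∀ (σ : absoluteGaloisGroup (v.adicCompletion ℚ)) (n : ℕ), IsFrobPow σ (n : ℤ) →
              ∃ s : ℤ, (s = 1 ∨ s = -1) ∧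
                ∀ (k : ℕ) (c : W.geomPrimaryTorsion p), c ∈ C → p ^ k • c = 0 →
                  ∀ N : ℤ, ((N : ℤ_[p]) - s *
                      ((GaloisRep.cyclotomicCharacter ℚ p
                          (absGaloisRestrict ℚ (v.adicCompletion ℚ) σ) * (α⁻¹) ^ n : ℤ_[p]ˣ) :
                        ℤ_[p]) ∈ (Ideal.span {(p : ℤ_[p]) ^ k} : Ideal ℤ_[p])) →
                    absGaloisRestrict ℚ (v.adicCompletion ℚ) σ • c = N • c) := by
  intro W _ _ p _ _ hp2 hX hS v hpv
  exact lineCharacter_rat_of_subGordTwo_of_unitRoot hp2 hpv (fun V _ _ hV hΔ ↦ hunit p v hpv V hV hΔ)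
    W hX hS

/-- **Registered stub `stub_finV_gordTwo` of crux `LocalTowerTorsionFiniteX3`
(stmt-BirchSwinnertonDyer-19546) from the CFT fact and FILE 1** — signature verbatim as conclusion:
(i) `ZpExtension.exists_isFrobPow_mem_kerSubgroup_of_isAnticyclotomic` (cite-only), (FILE 1) `hunit`;
everything else — the line, its twist, its transport to `(K, 𝔭)`, the weight argument — is kernel-checked
(gen 5 p440899/p444310/p446206, FILE 2 p457112, FILE 3 p457099).
[cite: JetchevSkinnerWan2017, §3.3 Prop. 3.3.4 Case 3(b), Remark 3.3.5 (arXiv:1512.06894 p. 13)] -/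
theorem stub_finV_gordTwo_of_CFT_of_unitRoot
    (hCFT : ∀ (K : Type) [Field K] [NumberField K] (p : ℕ) [Fact p.Prime],
      ZpExtension.exists_isFrobPow_mem_kerSubgroup_of_isAnticyclotomic K p)
    (hunit : ∀ (p : ℕ) [Fact p.Prime] (v : HeightOneSpectrum (𝓞 ℚ))
      (hpv : ((p : ℕ) : 𝓞 ℚ) ∈ v.asIdeal) (V : WeierstrassCurve ℚ) [V.IsElliptic] [V.IsGloballyMinimal],
      GoodOrd V p → ∀ (hΔ : ¬ (p : ℤ) ∣ minimalDiscriminantInt V), ∃ (a : ℤ) (α : ℤ_[p]ˣ),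
      ((α : ℤ_[p])) ^ 2 = a * (α : ℤ_[p]) - p ∧
      ∀ (σ : absoluteGaloisGroup (v.adicCompletion ℚ)) (n : ℕ), IsFrobPow σ (n : ℤ) →
        ∀ (k : ℕ) (c : V.geomPrimaryTorsion p), c ∈ (reductionDatum V p hpv hΔ).plus → p ^ k • c = 0 →
          ∀ N : ℤ, ((N : ℤ_[p]) -
              ((GaloisRep.cyclotomicCharacter ℚ p (absGaloisRestrict ℚ (v.adicCompletion ℚ) σ) *
                (α⁻¹) ^ n : ℤ_[p]ˣ) : ℤ_[p]) ∈ (Ideal.span {(p : ℤ_[p]) ^ k} : Ideal ℤ_[p])) →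
            absGaloisRestrict ℚ (v.adicCompletion ℚ) σ • c = N • c) :
    ∀ (W : WeierstrassCurve ℚ) [W.IsElliptic] [W.IsGloballyMinimal] (p : ℕ) [Fact p.Prime],
      W.analyticRank = 1 → p ≠ 2 → Literature.NumberTheory.EllipticCurves.Rank1Residual.ClassX3 W p →
        Summit.BirchSwinnertonDyer.Rank1Residual.Additive.SubGordTwo W p →
        (∀ (K : Type) [Field K] [NumberField K],
          Literature.NumberTheory.EllipticCurves.IsImaginaryQuadratic K →
          Summit.BirchSwinnertonDyer.Rank1Residual.X11b.SplitsIn K p →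
          ∀ (κ : Literature.NumberTheory.EllipticCurves.ZpExtension K p), κ.IsAnticyclotomic →
          ∀ (𝔭 : IsDedekindDomain.HeightOneSpectrum (NumberField.RingOfIntegers K)),
            ((p : ℕ) : NumberField.RingOfIntegers K) ∈ 𝔭.asIdeal →
            (FixedPoints.addSubgroup ↥(Literature.NumberTheory.EllipticCurves.GreenbergSelmer.decomp 𝔭 ⊓
              κ.kerSubgroup) ((W.baseChange K).geomPrimaryTorsion p) :
            Set ((W.baseChange K).geomPrimaryTorsion p)).Finite) :=
  stub_finV_gordTwo_of_lineCharacterRat hCFT (hLineRat_gordTwo_of_unitRoot hunit)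

/-- **The crux decl `LocalTowerTorsionFiniteX3` (stmt-BirchSwinnertonDyer-19546) BY NAME from the CFT
fact and FILE 1**: (M) half by door-c2 g5's `localTowerTorsionFiniteX3_of_facts_of_stub_gordTwo` with the
PROVED twisted Tate uniformisation `TateCurve.Silverman1994_thmV53_corV54_tateUniformisation_holds`,
(G-ord, `e = 2`) half by `stub_finV_gordTwo_of_CFT_of_unitRoot`.
[cite: JetchevSkinnerWan2017, §3.3 Prop. 3.3.4 Case 3(b), Remark 3.3.5 (arXiv:1512.06894 p. 13)]
[cite: SilvermanATAEC1994, Ch. V Thm. 5.3, Cor. 5.4] -/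
theorem localTowerTorsionFiniteX3_of_CFT_of_unitRoot
    (hCFT : ∀ (K : Type) [Field K] [NumberField K] (p : ℕ) [Fact p.Prime],
      ZpExtension.exists_isFrobPow_mem_kerSubgroup_of_isAnticyclotomic K p)
    (hunit : ∀ (p : ℕ) [Fact p.Prime] (v : HeightOneSpectrum (𝓞 ℚ))
      (hpv : ((p : ℕ) : 𝓞 ℚ) ∈ v.asIdeal) (V : WeierstrassCurve ℚ) [V.IsElliptic] [V.IsGloballyMinimal],
      GoodOrd V p → ∀ (hΔ : ¬ (p : ℤ) ∣ minimalDiscriminantInt V), ∃ (a : ℤ) (α : ℤ_[p]ˣ),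
      ((α : ℤ_[p])) ^ 2 = a * (α : ℤ_[p]) - p ∧
      ∀ (σ : absoluteGaloisGroup (v.adicCompletion ℚ)) (n : ℕ), IsFrobPow σ (n : ℤ) →
        ∀ (k : ℕ) (c : V.geomPrimaryTorsion p), c ∈ (reductionDatum V p hpv hΔ).plus → p ^ k • c = 0 →
          ∀ N : ℤ, ((N : ℤ_[p]) -
              ((GaloisRep.cyclotomicCharacter ℚ p (absGaloisRestrict ℚ (v.adicCompletion ℚ) σ) *
                (α⁻¹) ^ n : ℤ_[p]ˣ) : ℤ_[p]) ∈ (Ideal.span {(p : ℤ_[p]) ^ k} : Ideal ℤ_[p])) →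
            absGaloisRestrict ℚ (v.adicCompletion ℚ) σ • c = N • c) :
    LocalTowerTorsionFiniteX3 :=
  localTowerTorsionFiniteX3_of_facts_of_stub_gordTwo hCFT
    Literature.NumberTheory.EllipticCurves.TateCurve.Silverman1994_thmV53_corV54_tateUniformisation_holds
    (stub_finV_gordTwo_of_CFT_of_unitRoot hCFT hunit)

/-- **The rev-14 F-record `LocalTowerTorsionFiniteX3F` (stmt-BirchSwinnertonDyer-19668) BY NAME from
FILE 1 alone** (its one explicit antecedent, the CFT fact, is the binder of the record). Closer, the hour
FILE 1 lands: `fun hFILE1 ↦ localTowerTorsionFiniteX3F_of_unitRoot hFILE1` — i.e.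
`localTowerTorsionFiniteX3F_of_unitRoot ‹FILE 1›` has type `LocalTowerTorsionFiniteX3F` verbatim.
[cite: JetchevSkinnerWan2017, §3.3 Prop. 3.3.4 Case 3(b), Remark 3.3.5 (arXiv:1512.06894 p. 13)] -/
theorem localTowerTorsionFiniteX3F_of_unitRoot
    (hunit : ∀ (p : ℕ) [Fact p.Prime] (v : HeightOneSpectrum (𝓞 ℚ))
      (hpv : ((p : ℕ) : 𝓞 ℚ) ∈ v.asIdeal) (V : WeierstrassCurve ℚ) [V.IsElliptic] [V.IsGloballyMinimal],
      GoodOrd V p → ∀ (hΔ : ¬ (p : ℤ) ∣ minimalDiscriminantInt V), ∃ (a : ℤ) (α : ℤ_[p]ˣ),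
      ((α : ℤ_[p])) ^ 2 = a * (α : ℤ_[p]) - p ∧
      ∀ (σ : absoluteGaloisGroup (v.adicCompletion ℚ)) (n : ℕ), IsFrobPow σ (n : ℤ) →
        ∀ (k : ℕ) (c : V.geomPrimaryTorsion p), c ∈ (reductionDatum V p hpv hΔ).plus → p ^ k • c = 0 →
          ∀ N : ℤ, ((N : ℤ_[p]) -
              ((GaloisRep.cyclotomicCharacter ℚ p (absGaloisRestrict ℚ (v.adicCompletion ℚ) σ) *
                (α⁻¹) ^ n : ℤ_[p]ˣ) : ℤ_[p]) ∈ (Ideal.span {(p : ℤ_[p]) ^ k} : Ideal ℤ_[p])) →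
            absGaloisRestrict ℚ (v.adicCompletion ℚ) σ • c = N • c) :
    LocalTowerTorsionFiniteX3F :=
  fun hCFT ↦ localTowerTorsionFiniteX3_of_CFT_of_unitRoot hCFT hunit

/-- **The rev-14 F-record `AnticycControlAdditiveKFF` (stmt-BirchSwinnertonDyer-19669) BY NAME from
FILE 1 alone**: the anticyclotomic control EQUALITY under the CFT fact, from the Fin_v record and the
closed regimes (door-c4 g3 `anticycControlAdditiveKF_of_finV_of_regimeB2` p442095 +
`controlGlobalPTorsionF_holds` p443572). [cite: JetchevSkinnerWan2017, §3.3 Prop. 3.3.1, Thm. 3.3.3 (arXiv:1512.06894)]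
[cite: GreenbergLNM1716, §3 Lemma 3.3] -/
theorem anticycControlAdditiveKFF_of_unitRoot
    (hunit : ∀ (p : ℕ) [Fact p.Prime] (v : HeightOneSpectrum (𝓞 ℚ))
      (hpv : ((p : ℕ) : 𝓞 ℚ) ∈ v.asIdeal) (V : WeierstrassCurve ℚ) [V.IsElliptic] [V.IsGloballyMinimal],
      GoodOrd V p → ∀ (hΔ : ¬ (p : ℤ) ∣ minimalDiscriminantInt V), ∃ (a : ℤ) (α : ℤ_[p]ˣ),
      ((α : ℤ_[p])) ^ 2 = a * (α : ℤ_[p]) - p ∧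
      ∀ (σ : absoluteGaloisGroup (v.adicCompletion ℚ)) (n : ℕ), IsFrobPow σ (n : ℤ) →
        ∀ (k : ℕ) (c : V.geomPrimaryTorsion p), c ∈ (reductionDatum V p hpv hΔ).plus → p ^ k • c = 0 →
          ∀ N : ℤ, ((N : ℤ_[p]) -
              ((GaloisRep.cyclotomicCharacter ℚ p (absGaloisRestrict ℚ (v.adicCompletion ℚ) σ) *
                (α⁻¹) ^ n : ℤ_[p]ˣ) : ℤ_[p]) ∈ (Ideal.span {(p : ℤ_[p]) ^ k} : Ideal ℤ_[p])) →
            absGaloisRestrict ℚ (v.adicCompletion ℚ) σ • c = N • c) :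
    AnticycControlAdditiveKFF :=
  fun hCFT ↦ anticycControlAdditiveKF_of_finV_of_regimeB2
    (localTowerTorsionFiniteX3F_of_unitRoot hunit hCFT) controlGlobalPTorsionF_holds

end Summit.BirchSwinnertonDyer.BirchSwinnertonDyer.Theorems.SchneiderFreeAdditiveX3

end
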